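import Mathlib
import Summits.ResolutionOfSingularities.ResolutionOfSingularities.Theorems.WildQuotientsWildQuotientResolutionJordanFiveTwistedChart

/-!
# R-T rung (J₅) — the weight-`24` invariant `U₈` (numerator of the integration constant `η₂`) and its value on the universal twisted chart

(crux stmt-ResolutionOfSingularities-15640 `WildQuotients.WildQuotientResolution`, line `Sketch`;
chain w45c RUNG V5 HP₁ (res-L1-w45c-plan-1 NAMED 11:35:13Z: stub-1 = T2-analogue `eE` + final);
design `L/res-L1-w45c-idea-2/RT-J5.md` §1/§4 («η₂ = U₈/(24H′⁴), U₈ an invariant of degree 8 … involves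
x₄»); found as a polynomial in the tree's invariants by kit j277343 (exact linear algebra), value on the
chart with cofactors from kit j277890. [OURS · L1 W4.5c] — NOT a statement of any manuscript (Hironaka
2017 is consumed nowhere); replaces the role of no printed item. Prover res-L1-w45c-stub-1. AI-written
Lean, kernel-checked; weaker than expert review.)

`U₈ := −T′²·(2j₃) + 3H′Δ₇ − 9H′²i₂T′ − 3H′³(2j₃) − 6H′³T′ + 9x_aH′²i₂² + 6x_aH′³i₂ + 3x_a²H′i₂(2j₃)`
(`H′ = JordanFour.hPrime`, `T′ = tPrime`, `Δ₇ = delta7`, `i₂ = JordanFive.iTwo`, `2j₃ = jThreeTwo`):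
standard degree `9`, every monomial of `(4,3,2,1,0)`-weight `≥ 24` (so `U₈ ∈ I₁₂²` by
`…JordanFiveI12Powers`), `σ`-invariant, and — the point — **`ψ₅(U₈) = 24·η₂·ψ₅(H′)⁴ = 24·X e·(l⁶Q)⁴`**:
it is the inverse-dictionary entry for the last chart coordinate `η₂ = X e` of the T2-analogue
(`η₂ = (U₈t²)/(H′²t)²·(1/24)` on `chartW₁`), exactly as `Δ₇` serves `η₁`.
* `JordanFive.uEight`, `JordanFive.map_uEight` (invariance for the `J₅` law),
* `JordanFive.twistedChart_uEight` (cleared by `16`: `linear_combination` over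
  `twelve_mul_twistedChart_iTwo` and `four_mul_twistedChart_jThreeTwo`).
-/

-- single-problem summit: the doubled namespace component `ResolutionOfSingularities` is forced
set_option linter.dupNamespace false

noncomputable section

open MvPolynomial

namespace Summit.ResolutionOfSingularities.ResolutionOfSingularities.Theorems.WildQuotientResolution.JordanFive

section Defs

variable (k : Type) [Field k] (n : ℕ) (a b c d e : Fin n)

/-- **`U₈ = −T′²(2j₃) + 3H′Δ₇ − 9H′²i₂T′ − 3H′³(2j₃) − 6H′³T′ + 9x_aH′²i₂² + 6x_aH′³i₂ + 3x_a²H′i₂(2j₃)`**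
— the `σ`-invariant of weight `≥ 24` with `ψ₅(U₈) = 24 η₂ ψ₅(H′)⁴` (RT-J5 §1 (C): the numerator of the
integration constant `c₄ = η₂ = U₈/(24H′⁴)`). [OURS · L1 W4.5c] -/
def uEight : MvPolynomial (Fin n) k :=
  -(JordanFour.tPrime k n a b c d ^ 2 * jThreeTwo k n a b c d e) +
    3 * (JordanFour.hPrime k n a b c * JordanFour.delta7 k n a b c d) -
    9 * (JordanFour.hPrime k n a b c ^ 2 * iTwo k n a b c d e * JordanFour.tPrime k n a b c d) -
    3 * (JordanFour.hPrime k n a b c ^ 3 * jThreeTwo k n a b c d e) -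
    6 * (JordanFour.hPrime k n a b c ^ 3 * JordanFour.tPrime k n a b c d) +
    9 * (X a * JordanFour.hPrime k n a b c ^ 2 * iTwo k n a b c d e ^ 2) +
    6 * (X a * JordanFour.hPrime k n a b c ^ 3 * iTwo k n a b c d e) +
    3 * (X a ^ 2 * JordanFour.hPrime k n a b c * iTwo k n a b c d e * jThreeTwo k n a b c d e)

end Defs

section Laws

variable (k : Type) [Field k] (n : ℕ) (a b c d e : Fin n)
  (hab : a ≠ b) (hac : a ≠ c) (had : a ≠ d) (hae : a ≠ e) (hbc : b ≠ c) (hbd : b ≠ d) (hbe : b ≠ e)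
  (hcd : c ≠ d) (hce : c ≠ e) (hde : d ≠ e)
  (σ : MvPolynomial (Fin n) k →ₐ[k] MvPolynomial (Fin n) k)
  (hσa : σ (X a) = X a) (hσb : σ (X b) = X b + X a) (hσc : σ (X c) = X c + X b)
  (hσd : σ (X d) = X d + X c) (hσe : σ (X e) = X e + X d)

include hσa hσb hσc hσd hσe in
/-- **`σ U₈ = U₈`** (any `k`-algebra endomorphism with the `J₅` law). [OURS · L1 W4.5c] -/
theorem map_uEight : σ (uEight k n a b c d e) = uEight k n a b c d e := by
  simp only [uEight, map_add, map_sub, map_neg, map_mul, map_pow, map_ofNat, hσa,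
    map_hPrime k n a b c σ hσa hσb hσc, map_tPrime k n a b c d σ hσa hσb hσc hσd,
    map_delta7 k n a b c d σ hσa hσb hσc hσd, map_iTwo k n a b c d e σ hσa hσb hσc hσd hσe,
    map_jThreeTwo k n a b c d e σ hσa hσb hσc hσd hσe]

/-- `16 ≠ 0` in `k[x]` when `2 ∈ kˣ`. [folklore] -/
theorem sixteen_ne_zero_poly (h2 : (2 : k) ≠ 0) : (16 : MvPolynomial (Fin n) k) ≠ 0 := by
  have h : (16 : MvPolynomial (Fin n) k) = C (2 ^ 4 : k) := by
    rw [map_pow, map_ofNat]; norm_num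
  rw [h, Ne, C_eq_zero]
  exact pow_ne_zero 4 h2

include hab hac had hae hbc hbd hbe hcd hce hde in
/-- **`ψ₅(U₈) = 24·η₂·(l⁶Q)⁴ = 24 η₂ ψ₅(H′)⁴`** — the inverse-dictionary identity for `η₂`
(`2, 3 ∈ kˣ`; cleared by `16`, cofactors kit j277890 over the `i₂` and `2j₃` chart identities).
[OURS · L1 W4.5c] -/
theorem twistedChart_uEight (h2 : (2 : k) ≠ 0) (h3 : (3 : k) ≠ 0) :
    twistedChart k n a b c d e (uEight k n a b c d e) =
      24 * X e * (X b ^ 6 * JordanFour.twistedQ k n a b d) ^ 4 := by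
  have hI := twelve_mul_twistedChart_iTwo k n a b c d e hab hac had hae hbc hbd hbe hcd hce hde h2 h3
  have hJ := four_mul_twistedChart_jThreeTwo k n a b c d e hab hac had hae hbc hbd hbe hcd hce hde h2 h3
  simp only [JordanFour.twistedQ] at hJ
  refine mul_left_cancel₀ (sixteen_ne_zero_poly k n h2) ?_
  simp only [uEight, JordanFour.twistedQ, map_add, map_sub, map_neg, map_mul, map_pow, map_ofNat,
    twistedChart_X_a, twistedChart_hPrime k n a b c d e hab hac hbc h2,
    twistedChart_tPrime k n a b c d e hab hac had hbc hbd hcd h2 h3,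
    twistedChart_delta7 k n a b c d e hab hac had hbc hbd hcd h2 h3]
  linear_combination (3*(X a)^7*(X d)^4*(X b)^20 + 2*(X a)^7*(X d)^3*(X b)^22 - 42*(X a)^6*(X d)^3*(X b)^21
      + 24*(X a)^6*(X d)^2*(X e)*(X b)^20 - 12*(X a)^6*(X d)^2*(X b)^23 + 10*(X a)^5*(X d)^3*(X b)^20
      + 211*(X a)^5*(X d)^2*(X b)^22
      + 12*(X a)^5*(X d)^2*(X b)^16*(twistedChart k n a b c d e (iTwo k n a b c d e))
      - 144*(X a)^5*(X d)*(X e)*(X b)^21 + 18*(X a)^5*(X d)*(X b)^24 - 102*(X a)^4*(X d)^2*(X b)^21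
      + 48*(X a)^4*(X d)*(X e)*(X b)^20 - 444*(X a)^4*(X d)*(X b)^23
      - 72*(X a)^4*(X d)*(X b)^17*(twistedChart k n a b c d e (iTwo k n a b c d e))
      + 4*(X a)^4*(X d)*(X b)^14*(twistedChart k n a b c d e (jThreeTwo k n a b c d e))
      + 216*(X a)^4*(X e)*(X b)^22 + 11*(X a)^3*(X d)^2*(X b)^20 + 326*(X a)^3*(X d)*(X b)^22
      + 24*(X a)^3*(X d)*(X b)^16*(twistedChart k n a b c d e (iTwo k n a b c d e))
      - 144*(X a)^3*(X e)*(X b)^21 + 324*(X a)^3*(X b)^24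
      + 108*(X a)^3*(X b)^18*(twistedChart k n a b c d e (iTwo k n a b c d e))
      - 12*(X a)^3*(X b)^15*(twistedChart k n a b c d e (jThreeTwo k n a b c d e))
      - 72*(X a)^2*(X d)*(X b)^21 + 24*(X a)^2*(X e)*(X b)^20 - 324*(X a)^2*(X b)^23
      - 72*(X a)^2*(X b)^17*(twistedChart k n a b c d e (iTwo k n a b c d e))
      + 4*(X a)^2*(X b)^14*(twistedChart k n a b c d e (jThreeTwo k n a b c d e))
      + 4*(X a)*(X d)*(X b)^20 + 108*(X a)*(X b)^22
      + 12*(X a)*(X b)^16*(twistedChart k n a b c d e (iTwo k n a b c d e)) - 12*(X b)^21) * hI +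
    (-9*(X a)^6*(X d)^3*(X b)^18 - 6*(X a)^6*(X d)^2*(X b)^20 + 87*(X a)^5*(X d)^2*(X b)^19
      + 24*(X a)^5*(X d)*(X e)*(X b)^18 + 42*(X a)^5*(X d)*(X b)^21 - 33*(X a)^4*(X d)^2*(X b)^18
      - 302*(X a)^4*(X d)*(X b)^20 - 72*(X a)^4*(X e)*(X b)^19 - 72*(X a)^4*(X b)^22
      + 216*(X a)^3*(X d)*(X b)^19 + 24*(X a)^3*(X e)*(X b)^18 + 372*(X a)^3*(X b)^21
      - 40*(X a)^2*(X d)*(X b)^18 - 368*(X a)^2*(X b)^20 + 132*(X a)*(X b)^19 - 16*(X b)^18) * hJ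

end Laws

end Summit.ResolutionOfSingularities.ResolutionOfSingularities.Theorems.WildQuotientResolution.JordanFive

end
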